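import Literature.Barriers.AtomisticToContinuum.CasimirBoxGeneralizedCondensation
import Mathlib.MeasureTheory.Integral.Bochner.Set
import Mathlib.MeasureTheory.Measure.Lebesgue.Basic
import Mathlib.MeasureTheory.Integral.Pi
import Mathlib.MeasureTheory.Integral.DominatedConvergence
import Mathlib.MeasureTheory.Constructions.Pi
import Mathlib.Analysis.SpecialFunctions.Gaussian.GaussianIntegral
import Mathlib.Analysis.SpecialFunctions.Gamma.Basic
import Mathlib.Analysis.PSeries
import Mathlib.Topology.Algebra.InfiniteSum.Real
import Mathlib.Topology.Algebra.InfiniteSum.Order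
import Mathlib.Algebra.Order.Floor.Semiring

/-!
# Proof of the van den Berg–Lewis–Pulé generalized-condensate fact for Casimir boxes

This file discharges the named fact
`Literature.Barriers.AtomisticToContinuum.BoseGas.Casimir.VandenBergLewisPule1986_generalizedCondensate`
of `Literature/Barriers/AtomisticToContinuum/CasimirBoxGeneralizedCondensation.lean`
(`VandenBergLewisPule1986_generalizedCondensate_holds`, at the end of the file): for the perfect
Bose gas in the Casimir boxes `Λ_V = ∏_j [0, V^{α_j}]` (`α₁ ≥ α₂ ≥ α₃ > 0`, `∑ α_j = 1`) at
inverse temperature `β > 0` and density `ρ > ρ_c(β)`, and for every eventual family of roots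
`μ_V = μ_V(ρ) < E₁(V)` of the density equation `ρ = V⁻¹ ∑_n (e^{β(ε_{n,V}-μ)} - 1)⁻¹`, the band
occupations `V⁻¹ ∑_{n : ε_{n,V} < ε} ⟨N_n⟩(μ_V)` converge for every `ε > 0` and their limit tends
to `ρ - ρ_c` as `ε ↓ 0` — "`ρ₀ := lim_{ε↓0} lim_{V→∞} V⁻¹∑_{k : E_k(V) < ε} ⟨N_k⟩_V^{gcan}(μ_V(ρ))
= ρ - ρ_c`, for `ρ > ρ_c`" [PuleZagrebnov2004, §1], "a standard result [BergLewisPule-86]":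
"the boundedness of the critical density implies the existence of generalized BEC".

## The printed architecture and the proof given here

Pulé–Zagrebnov §1 define the finite-volume integrated density of states
`F_V(η) = V⁻¹#{k : η_k(V) ≤ η}`, note `F(η) := lim_V F_V(η) = (√2/3π²)η^{3/2}` ("one can prove in
many ways, for example by using Lemma 3.1", the lattice-point count of an ellipsoid octant, "or by
taking the Laplace transform"), whence `ρ_c = ∫₀^∞ (e^{βη}-1)⁻¹F(dη) < ∞`, and quote the general
theory [VandenbergLewisPule1986] for `ρ₀ = ρ - ρ_c`; Prop. 2.1 ([VandenbergLewis1982, Thm. 1])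
records `μ_V(ρ) - E₁(V) → 0` for `ρ > ρ_c`. The proof below follows exactly this route, with the
Weyl law in Riemann-sum form:

* **Lattice Riemann sums** (`tendsto_mul_tsum_latticePt`, [folklore]): for `g ≥ 0` antitone
  (coordinatewise) and integrable on the open orthant `(0,∞)^ι`, and meshes `h_{V,j} ↓ 0`,
  `(∏_j h_{V,j}) ∑_{n ∈ ℕ_{≥1}^ι} g(h_V·n) → ∫_{(0,∞)^ι} g`: the sum is squeezed between the
  integrals over the tilings by the cells `∏(h_j(n_j-1), h_jn_j]` (of `(0,∞)^ι`) and
  `∏[h_jn_j, h_j(n_j+1))` (of `∏[h_j,∞)`), and `∫_{∏[h_j,∞)} g → ∫_{(0,∞)^ι} g`. With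
  `h_{V,j} = V^{-α_j}` (cell volume `V⁻¹`) and `ε_{n,V} = e(h_V·n)`, `e(k) = (π²/2)|k|²`, this gives
  `V⁻¹∑_n φ(ε_{n,V}) → ∫_{(0,∞)³} φ(e(k)) dk` for `φ ≥ 0` antitone on `(0,∞)`
  (`tendsto_inv_mul_tsum_comp_level`) — the limit `F_V → F` tested against antitone functions.
* **The critical density** (`integral_orthant_gcOccupation_energy`):
  `∫_{(0,∞)³} (e^{βe(k)}-1)⁻¹ dk = ρ_c(β)` as defined in the barrier file
  (`∫₀^∞ (√2/2π²)√η (e^{βη}-1)⁻¹ dη`): expand `(e^{x}-1)⁻¹ = ∑_{ℓ≥1} e^{-ℓx}`, integrate the octant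
  Gaussians (`∏_j ∫₀^∞ e^{-ℓβπ²x²/2}dx`) and the moments `∫₀^∞ √η e^{-ℓβη}dη = Γ(3/2)(ℓβ)^{-3/2}`;
  both sides equal `∑_ℓ (2πℓβ)^{-3/2}`. This also proves `ρ_c < ∞` (integrability on the octant).
* **`μ_V → 0`** (`tendsto_chemicalPotential_zero`): `μ_V < E₁(V) → 0`, and if `μ_V ≤ a < 0`
  along a subsequence then `ρ ≤ V⁻¹∑_n ⟨N_n⟩(a) → ∫ (e^{β(e(k)-a)}-1)⁻¹ ≤ ρ_c < ρ`.
* **Tails** (`tendsto_inv_mul_tsum_tail`): for `ε > 0`, `V⁻¹∑_{ε_n ≥ ε} ⟨N_n⟩(μ_V)` is squeezed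
  between `c(|μ_V|)` and `C(|μ_V|)` times `V⁻¹∑_{ε_n ≥ ε}(e^{βε_n}-1)⁻¹ → ∫_{e ≥ ε}(e^{βe}-1)⁻¹`
  with explicit ratios `c, C → 1`; the density equation turns this into the convergence of the
  band occupation to `g(ε) = ρ - ∫_{e ≥ ε}(e^{βe(k)}-1)⁻¹dk` (`tendsto_bandOccupation`), and
  dominated convergence gives `g(ε) → ρ - ρ_c` (`tendsto_truncatedIntegral`).

The statement is proved for all Casimir exponents (types I, II and III alike), as printed.
Deliberately NOT here: the rates of Prop. 2.1, uniqueness of `μ_V(ρ)`, the pointwise Weyl law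
`F_V(η) → F(η)` as a separate statement (it is the case `φ = 𝟙_{(0,η]}` of
`tendsto_inv_mul_tsum_comp_level`, not needed in this form).

## References

* [PuleZagrebnov2004] J. V. Pulé, V. A. Zagrebnov, *The canonical perfect Bose gas in Casimir
  boxes*, J. Math. Phys. 45 (2004) 3565–3583, arXiv:math-ph/0405043 (read: §1 — (lim-IDS),
  (cr-dens), the `ρ₀` display —, Prop. 2.1–2.2, Lemma 3.1 with proof).
* [VandenbergLewisPule1986] M. van den Berg, J. T. Lewis, J. V. Pulé, *A general theory of
  Bose–Einstein condensation*, Helv. Phys. Acta 59 (1986) 1271–1288 (not held; cited via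
  PuleZagrebnov2004 §1).
* [VandenbergLewis1982] M. van den Berg, J. T. Lewis, *On generalized condensation in the free
  boson gas*, Physica A 110 (1982) 550–564 (PZ's [BergLew-82], Prop. 2.1; not re-read).
-/

noncomputable section

open MeasureTheory Set Filter Topology
open scoped BigOperators ENNReal

namespace Literature.Barriers.AtomisticToContinuum.BoseGas.Casimir

variable {ι : Type*} [Fintype ι]

/-- The open positive orthant `(0,∞)^ι`. [folklore] -/
def orthant (ι : Type*) : Set (ι → ℝ) := Set.pi univ fun _ => Ioi 0

/-- The point `(h_j n_j)_j` of the rectangular lattice `∏_j h_j ℕ_{≥ 1}`. [folklore] -/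
def latticePt (h : ι → ℝ) (n : ι → ℕ+) : ι → ℝ := fun j => h j * ((n j : ℕ) : ℝ)

/-- The lower cell `∏_j (h_j (n_j - 1), h_j n_j]`, whose top corner is the lattice point `h·n`.
[folklore] -/
def lowerCell (h : ι → ℝ) (n : ι → ℕ+) : Set (ι → ℝ) :=
  Set.pi univ fun j => Ioc (h j * (((n j : ℕ) : ℝ) - 1)) (h j * ((n j : ℕ) : ℝ))

/-- The upper cell `∏_j [h_j n_j, h_j (n_j + 1))`, whose bottom corner is the lattice point `h·n`.
[folklore] -/
def upperCell (h : ι → ℝ) (n : ι → ℕ+) : Set (ι → ℝ) :=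
  Set.pi univ fun j => Ico (h j * ((n j : ℕ) : ℝ)) (h j * (((n j : ℕ) : ℝ) + 1))

omit [Fintype ι] in
/-- The orthant is measurable. [folklore] -/
theorem measurableSet_orthant [Countable ι] : MeasurableSet (orthant ι) :=
  MeasurableSet.pi countable_univ fun _ _ => measurableSet_Ioi

omit [Fintype ι] in
/-- Lower cells are measurable. [folklore] -/
theorem measurableSet_lowerCell [Countable ι] (h : ι → ℝ) (n : ι → ℕ+) :
    MeasurableSet (lowerCell h n) :=
  MeasurableSet.pi countable_univ fun _ _ => measurableSet_Ioc

omit [Fintype ι] in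
/-- Upper cells are measurable. [folklore] -/
theorem measurableSet_upperCell [Countable ι] (h : ι → ℝ) (n : ι → ℕ+) :
    MeasurableSet (upperCell h n) :=
  MeasurableSet.pi countable_univ fun _ _ => measurableSet_Ico

omit [Fintype ι] in
/-- `1 ≤ n_j` as reals. [folklore] -/
theorem one_le_pnat_cast (n : ι → ℕ+) (j : ι) : (1 : ℝ) ≤ ((n j : ℕ) : ℝ) := by
  exact_mod_cast (n j).pos

omit [Fintype ι] in
/-- Lattice points lie in the open orthant. [folklore] -/
theorem latticePt_pos {h : ι → ℝ} (hh : ∀ j, 0 < h j) (n : ι → ℕ+) (j : ι) :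
    0 < latticePt h n j :=
  mul_pos (hh j) (lt_of_lt_of_le one_pos (one_le_pnat_cast n j))

omit [Fintype ι] in
/-- Lower cells lie in the open orthant. [folklore] -/
theorem lowerCell_subset_orthant {h : ι → ℝ} (hh : ∀ j, 0 < h j) (n : ι → ℕ+) :
    lowerCell h n ⊆ orthant ι := by
  intro x hx j _
  have h1 : (0 : ℝ) ≤ ((n j : ℕ) : ℝ) - 1 := by linarith [one_le_pnat_cast n j]
  exact lt_of_le_of_lt (mul_nonneg (hh j).le h1) (hx j (mem_univ j)).1

omit [Fintype ι] in
/-- Upper cells lie in `∏_j [h_j, ∞)`. [folklore] -/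
theorem upperCell_subset_pi_Ici {h : ι → ℝ} (hh : ∀ j, 0 < h j) (n : ι → ℕ+) :
    upperCell h n ⊆ Set.pi univ fun j => Ici (h j) := by
  intro x hx j _
  have h1 := (hx j (mem_univ j)).1
  have h2 : h j ≤ h j * ((n j : ℕ) : ℝ) := le_mul_of_one_le_right (hh j).le (one_le_pnat_cast n j)
  exact h2.trans h1

omit [Fintype ι] in
/-- `∏_j [h_j, ∞)` lies in the open orthant. [folklore] -/
theorem pi_Ici_subset_orthant {h : ι → ℝ} (hh : ∀ j, 0 < h j) :
    (Set.pi univ fun j => Ici (h j)) ⊆ orthant ι :=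
  fun _ hx j _ => (hh j).trans_le (hx j (mem_univ j))

omit [Fintype ι] in
/-- A point of a lower cell lies below its lattice point. [folklore] -/
theorem le_latticePt_of_mem_lowerCell {h : ι → ℝ} {n : ι → ℕ+} {x : ι → ℝ}
    (hx : x ∈ lowerCell h n) (j : ι) : x j ≤ latticePt h n j :=
  (hx j (mem_univ j)).2

omit [Fintype ι] in
/-- A point of an upper cell lies above its lattice point. [folklore] -/
theorem latticePt_le_of_mem_upperCell {h : ι → ℝ} {n : ι → ℕ+} {x : ι → ℝ}
    (hx : x ∈ upperCell h n) (j : ι) : latticePt h n j ≤ x j :=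
  (hx j (mem_univ j)).1

omit [Fintype ι] in
/-- Distinct lower cells are disjoint. [folklore] -/
theorem pairwise_disjoint_lowerCell {h : ι → ℝ} (hh : ∀ j, 0 < h j) :
    Pairwise (Function.onFun Disjoint (lowerCell h)) := by
  intro n m hnm
  obtain ⟨j, hj⟩ : ∃ j, n j ≠ m j := Function.ne_iff.1 hnm
  have hne : (n j : ℕ) ≠ (m j : ℕ) := fun e => hj (PNat.coe_injective e)
  refine Set.disjoint_univ_pi.2 ⟨j, ?_⟩
  rw [Set.disjoint_iff]
  rintro t ⟨⟨h1, h2⟩, ⟨h3, h4⟩⟩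
  have a1 : ((n j : ℕ) : ℝ) - 1 < ((m j : ℕ) : ℝ) :=
    lt_of_mul_lt_mul_left (h1.trans_le h4) (hh j).le
  have a2 : ((m j : ℕ) : ℝ) - 1 < ((n j : ℕ) : ℝ) :=
    lt_of_mul_lt_mul_left (h3.trans_le h2) (hh j).le
  have b1 : (n j : ℕ) < (m j : ℕ) + 1 := by
    exact_mod_cast (show ((n j : ℕ) : ℝ) < ((m j : ℕ) : ℝ) + 1 by linarith)
  have b2 : (m j : ℕ) < (n j : ℕ) + 1 := by
    exact_mod_cast (show ((m j : ℕ) : ℝ) < ((n j : ℕ) : ℝ) + 1 by linarith)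
  omega

omit [Fintype ι] in
/-- Distinct upper cells are disjoint. [folklore] -/
theorem pairwise_disjoint_upperCell {h : ι → ℝ} (hh : ∀ j, 0 < h j) :
    Pairwise (Function.onFun Disjoint (upperCell h)) := by
  intro n m hnm
  obtain ⟨j, hj⟩ : ∃ j, n j ≠ m j := Function.ne_iff.1 hnm
  have hne : (n j : ℕ) ≠ (m j : ℕ) := fun e => hj (PNat.coe_injective e)
  refine Set.disjoint_univ_pi.2 ⟨j, ?_⟩
  rw [Set.disjoint_iff]
  rintro t ⟨⟨h1, h2⟩, ⟨h3, h4⟩⟩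
  have a1 : ((n j : ℕ) : ℝ) < ((m j : ℕ) : ℝ) + 1 :=
    lt_of_mul_lt_mul_left (h1.trans_lt h4) (hh j).le
  have a2 : ((m j : ℕ) : ℝ) < ((n j : ℕ) : ℝ) + 1 :=
    lt_of_mul_lt_mul_left (h3.trans_lt h2) (hh j).le
  have b1 : (n j : ℕ) < (m j : ℕ) + 1 := by exact_mod_cast a1
  have b2 : (m j : ℕ) < (n j : ℕ) + 1 := by exact_mod_cast a2
  omega

omit [Fintype ι] in
/-- The lower cells tile the open orthant. [folklore] -/
theorem iUnion_lowerCell {h : ι → ℝ} (hh : ∀ j, 0 < h j) :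
    ⋃ n, lowerCell h n = orthant ι := by
  refine Subset.antisymm (iUnion_subset fun n => lowerCell_subset_orthant hh n) ?_
  intro x hx
  have hx' : ∀ j, 0 < x j := fun j => hx j (mem_univ j)
  have hq : ∀ j, 0 < x j / h j := fun j => div_pos (hx' j) (hh j)
  refine mem_iUnion.2 ⟨fun j => ⟨⌈x j / h j⌉₊, Nat.ceil_pos.2 (hq j)⟩, fun j _ => ?_⟩
  have hj0 := hh j
  have h1 := Nat.ceil_lt_add_one (hq j).le
  have h2 := Nat.le_ceil (x j / h j)
  simp only [PNat.mk_coe, mem_Ioc]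
  constructor
  · calc h j * ((⌈x j / h j⌉₊ : ℝ) - 1) < h j * (x j / h j) :=
          mul_lt_mul_of_pos_left (by linarith) hj0
      _ = x j := by field_simp
  · calc x j = h j * (x j / h j) := by field_simp
      _ ≤ h j * (⌈x j / h j⌉₊ : ℝ) := mul_le_mul_of_nonneg_left h2 hj0.le

omit [Fintype ι] in
/-- The upper cells tile `∏_j [h_j, ∞)`. [folklore] -/
theorem iUnion_upperCell {h : ι → ℝ} (hh : ∀ j, 0 < h j) :
    ⋃ n, upperCell h n = Set.pi univ fun j => Ici (h j) := by
  refine Subset.antisymm (iUnion_subset fun n => upperCell_subset_pi_Ici hh n) ?_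
  intro x hx
  have hx' : ∀ j, h j ≤ x j := fun j => hx j (mem_univ j)
  have hq : ∀ j, 1 ≤ x j / h j := fun j => (one_le_div (hh j)).2 (hx' j)
  refine mem_iUnion.2 ⟨fun j => ⟨⌊x j / h j⌋₊, Nat.floor_pos.2 (hq j)⟩, fun j _ => ?_⟩
  have hj0 := hh j
  have hq0 : 0 ≤ x j / h j := zero_le_one.trans (hq j)
  have h1 := Nat.floor_le hq0
  have h2 := Nat.lt_floor_add_one (x j / h j)
  simp only [PNat.mk_coe, mem_Ico]
  constructor
  · calc h j * (⌊x j / h j⌋₊ : ℝ) ≤ h j * (x j / h j) := mul_le_mul_of_nonneg_left h1 hj0.le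
      _ = x j := by field_simp
  · calc x j = h j * (x j / h j) := by field_simp
      _ < h j * ((⌊x j / h j⌋₊ : ℝ) + 1) := mul_lt_mul_of_pos_left h2 hj0

/-- The volume of a lower cell is `∏_j h_j`. [folklore] -/
theorem volume_real_lowerCell {h : ι → ℝ} (hh : ∀ j, 0 < h j) (n : ι → ℕ+) :
    volume.real (lowerCell h n) = ∏ j, h j := by
  unfold lowerCell
  rw [measureReal_def, Real.volume_pi_Ioc_toReal]
  · exact Finset.prod_congr rfl fun j _ => by ring
  · intro j
    dsimp only
    nlinarith [hh j]

/-- The volume of an upper cell is `∏_j h_j`. [folklore] -/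
theorem volume_real_upperCell {h : ι → ℝ} (hh : ∀ j, 0 < h j) (n : ι → ℕ+) :
    volume.real (upperCell h n) = ∏ j, h j := by
  unfold upperCell
  rw [measureReal_def, Real.volume_pi_Ico_toReal]
  · exact Finset.prod_congr rfl fun j _ => by ring
  · intro j
    dsimp only
    nlinarith [hh j]

/-- Lower cells have finite volume. [folklore] -/
theorem volume_lowerCell_ne_top (h : ι → ℝ) (n : ι → ℕ+) : volume (lowerCell h n) ≠ ⊤ := by
  unfold lowerCell
  rw [Real.volume_pi_Ioc]
  exact (ENNReal.prod_lt_top fun _ _ => ENNReal.ofReal_lt_top).ne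

/-- Upper cells have finite volume. [folklore] -/
theorem volume_upperCell_ne_top (h : ι → ℝ) (n : ι → ℕ+) : volume (upperCell h n) ≠ ⊤ := by
  unfold upperCell
  rw [Real.volume_pi_Ico]
  exact (ENNReal.prod_lt_top fun _ _ => ENNReal.ofReal_lt_top).ne

/-! ### Riemann sums of antitone functions -/

section Antitone

variable {g : (ι → ℝ) → ℝ} {h : ι → ℝ}

/-- Lower cell: `(∏ h_j) g(h·n) ≤ ∫_{C_n} g` for `g` antitone on the orthant. [folklore] -/
theorem mul_apply_latticePt_le_setIntegral_lowerCell (hh : ∀ j, 0 < h j)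
    (hint : IntegrableOn g (orthant ι))
    (hanti : ∀ ⦃x y : ι → ℝ⦄, (∀ j, 0 < x j) → (∀ j, x j ≤ y j) → g y ≤ g x) (n : ι → ℕ+) :
    (∏ j, h j) * g (latticePt h n) ≤ ∫ x in lowerCell h n, g x := by
  have key := setIntegral_ge_of_const_le (c := g (latticePt h n)) (measurableSet_lowerCell h n)
    (volume_lowerCell_ne_top h n)
    (fun x hx => hanti (fun j => lowerCell_subset_orthant hh n hx j (mem_univ j))
      (fun j => le_latticePt_of_mem_lowerCell hx j))
    (hint.mono_set (lowerCell_subset_orthant hh n))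
  rwa [volume_real_lowerCell hh n, smul_eq_mul] at key

/-- Upper cell: `∫_{C'_n} g ≤ (∏ h_j) g(h·n)` for `g` antitone on the orthant. [folklore] -/
theorem setIntegral_upperCell_le_mul_apply_latticePt (hh : ∀ j, 0 < h j)
    (hint : IntegrableOn g (orthant ι))
    (hanti : ∀ ⦃x y : ι → ℝ⦄, (∀ j, 0 < x j) → (∀ j, x j ≤ y j) → g y ≤ g x) (n : ι → ℕ+) :
    ∫ x in upperCell h n, g x ≤ (∏ j, h j) * g (latticePt h n) := by
  have hsub : upperCell h n ⊆ orthant ι :=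
    (upperCell_subset_pi_Ici hh n).trans (pi_Ici_subset_orthant hh)
  calc ∫ x in upperCell h n, g x ≤ ∫ _ in upperCell h n, g (latticePt h n) :=
        setIntegral_mono_on (hint.mono_set hsub) (integrableOn_const (volume_upperCell_ne_top h n))
          (measurableSet_upperCell h n)
          (fun x hx => hanti (latticePt_pos hh n) (fun j => latticePt_le_of_mem_upperCell hx j))
    _ = (∏ j, h j) * g (latticePt h n) := by
        rw [setIntegral_const, volume_real_upperCell hh n, smul_eq_mul]

/-- **Upper Riemann bound.** For `g ≥ 0` antitone on the open orthant and integrable there, the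
lattice sums `(∏ h_j) ∑_{n ∈ ℕ_{≥1}^ι} g(h·n)` converge and are bounded by `∫_{(0,∞)^ι} g`.
[folklore] -/
theorem summable_latticePt_and_mul_tsum_le (hh : ∀ j, 0 < h j)
    (hint : IntegrableOn g (orthant ι))
    (hanti : ∀ ⦃x y : ι → ℝ⦄, (∀ j, 0 < x j) → (∀ j, x j ≤ y j) → g y ≤ g x)
    (hnn : ∀ ⦃x : ι → ℝ⦄, (∀ j, 0 < x j) → 0 ≤ g x) :
    Summable (fun n : ι → ℕ+ => g (latticePt h n)) ∧
      (∏ j, h j) * ∑' n : ι → ℕ+, g (latticePt h n) ≤ ∫ x in orthant ι, g x := by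
  have H0 : 0 < ∏ j, h j := Finset.prod_pos fun j _ => hh j
  have hsum : HasSum (fun n => ∫ x in lowerCell h n, g x) (∫ x in orthant ι, g x) := by
    have := hasSum_integral_iUnion (μ := volume) (f := g) (measurableSet_lowerCell h)
      (pairwise_disjoint_lowerCell hh) (by rw [iUnion_lowerCell hh]; exact hint)
    rwa [iUnion_lowerCell hh] at this
  have hle : ∀ n, (∏ j, h j) * g (latticePt h n) ≤ ∫ x in lowerCell h n, g x := fun n =>
    mul_apply_latticePt_le_setIntegral_lowerCell hh hint hanti n
  have hnn' : ∀ n, 0 ≤ (∏ j, h j) * g (latticePt h n) := fun n =>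
    mul_nonneg H0.le (hnn (latticePt_pos hh n))
  have hs1 : Summable fun n => (∏ j, h j) * g (latticePt h n) :=
    Summable.of_nonneg_of_le hnn' hle hsum.summable
  have hs2 : Summable fun n => g (latticePt h n) := by
    have := hs1.mul_left (∏ j, h j)⁻¹
    simpa only [inv_mul_cancel_left₀ H0.ne'] using this
  refine ⟨hs2, ?_⟩
  rw [← tsum_mul_left]
  calc ∑' n, (∏ j, h j) * g (latticePt h n) ≤ ∑' n, ∫ x in lowerCell h n, g x :=
        hs1.tsum_le_tsum hle hsum.summable
    _ = ∫ x in orthant ι, g x := hsum.tsum_eq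

/-- **Lower Riemann bound.** For `g ≥ 0` antitone on the open orthant and integrable there,
`∫_{∏[h_j,∞)} g ≤ (∏ h_j) ∑_{n ∈ ℕ_{≥1}^ι} g(h·n)`. [folklore] -/
theorem setIntegral_pi_Ici_le_mul_tsum (hh : ∀ j, 0 < h j)
    (hint : IntegrableOn g (orthant ι))
    (hanti : ∀ ⦃x y : ι → ℝ⦄, (∀ j, 0 < x j) → (∀ j, x j ≤ y j) → g y ≤ g x)
    (hnn : ∀ ⦃x : ι → ℝ⦄, (∀ j, 0 < x j) → 0 ≤ g x) :
    ∫ x in Set.pi univ (fun j => Ici (h j)), g x ≤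
      (∏ j, h j) * ∑' n : ι → ℕ+, g (latticePt h n) := by
  have hsum : HasSum (fun n => ∫ x in upperCell h n, g x)
      (∫ x in Set.pi univ (fun j => Ici (h j)), g x) := by
    have := hasSum_integral_iUnion (μ := volume) (f := g) (measurableSet_upperCell h)
      (pairwise_disjoint_upperCell hh)
      (by rw [iUnion_upperCell hh]; exact hint.mono_set (pi_Ici_subset_orthant hh))
    rwa [iUnion_upperCell hh] at this
  rw [← hsum.tsum_eq, ← tsum_mul_left]
  exact hsum.summable.tsum_le_tsum
    (fun n => setIntegral_upperCell_le_mul_apply_latticePt hh hint hanti n)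
    ((summable_latticePt_and_mul_tsum_le hh hint hanti hnn).1.mul_left _)

/-- **Riemann sums of antitone functions converge to the integral over the orthant.** If
`g ≥ 0` is antitone (coordinatewise) on the open orthant `(0,∞)^ι` and integrable there, and the
mesh `h_V = (h_{V,j})_j > 0` tends to `0` along a filter, then
`(∏_j h_{V,j}) ∑_{n ∈ ℕ_{≥1}^ι} g(h_V·n) → ∫_{(0,∞)^ι} g`. [folklore] -/
theorem tendsto_mul_tsum_latticePt {κ : Type*} {l : Filter κ} {hV : κ → ι → ℝ}
    (hint : IntegrableOn g (orthant ι))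
    (hanti : ∀ ⦃x y : ι → ℝ⦄, (∀ j, 0 < x j) → (∀ j, x j ≤ y j) → g y ≤ g x)
    (hnn : ∀ ⦃x : ι → ℝ⦄, (∀ j, 0 < x j) → 0 ≤ g x)
    (hpos : ∀ᶠ V in l, ∀ j, 0 < hV V j) (hlim : ∀ j, Tendsto (fun V => hV V j) l (𝓝 0)) :
    Tendsto (fun V => (∏ j, hV V j) * ∑' n : ι → ℕ+, g (latticePt (hV V) n)) l
      (𝓝 (∫ x in orthant ι, g x)) := by
  -- exhaustion of the orthant by `∏_j [1/(m+1), ∞)`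
  set s : ℕ → Set (ι → ℝ) := fun m => Set.pi univ fun _ => Ici (1 / ((m : ℝ) + 1)) with hs
  have hs_meas : ∀ m, MeasurableSet (s m) := fun m =>
    MeasurableSet.pi countable_univ fun _ _ => measurableSet_Ici
  have hs_mono : Monotone s := by
    intro m m' hmm' x hx j hj
    have h1 := hx j hj
    simp only [mem_Ici] at h1 ⊢
    have h2 : 1 / ((m' : ℝ) + 1) ≤ 1 / ((m : ℝ) + 1) :=
      one_div_le_one_div_of_le (by positivity) (by exact_mod_cast Nat.add_le_add_right hmm' 1)
    exact h2.trans h1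
  have hs_union : ⋃ m, s m = orthant ι := by
    refine Subset.antisymm (iUnion_subset fun m x hx j hj => ?_) fun x hx => ?_
    · exact lt_of_lt_of_le (by positivity : (0 : ℝ) < 1 / ((m : ℝ) + 1)) (hx j hj)
    · have hx' : ∀ j, 0 < x j := fun j => hx j (mem_univ j)
      have hex : ∀ j, ∃ m : ℕ, 1 / ((m : ℝ) + 1) < x j := fun j => exists_nat_one_div_lt (hx' j)
      choose m hm using hex
      refine mem_iUnion.2 ⟨Finset.univ.sup m, fun j _ => ?_⟩
      have hmj : (m j : ℝ) ≤ ((Finset.univ.sup m : ℕ) : ℝ) := by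
        exact_mod_cast Finset.le_sup (Finset.mem_univ j)
      simp only [mem_Ici]
      calc 1 / (((Finset.univ.sup m : ℕ) : ℝ) + 1) ≤ 1 / ((m j : ℝ) + 1) :=
            one_div_le_one_div_of_le (by positivity) (by linarith)
        _ ≤ x j := (hm j).le
  have hinner : Tendsto (fun m => ∫ x in s m, g x) atTop (𝓝 (∫ x in orthant ι, g x)) := by
    have := tendsto_setIntegral_of_monotone (μ := volume) (f := g) hs_meas hs_mono
      (by rw [hs_union]; exact hint)
    rwa [hs_union] at this
  rw [tendsto_order]
  constructor
  · intro a ha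
    obtain ⟨m, hm⟩ := (hinner.eventually (lt_mem_nhds ha)).exists
    have hsmall : ∀ᶠ V in l, ∀ j, hV V j < 1 / ((m : ℝ) + 1) :=
      eventually_all.2 fun j => (hlim j).eventually (gt_mem_nhds (by positivity))
    filter_upwards [hpos, hsmall] with V hVpos hVsmall
    calc a < ∫ x in s m, g x := hm
      _ ≤ ∫ x in Set.pi univ (fun j => Ici (hV V j)), g x := by
          refine setIntegral_mono_set (hint.mono_set (pi_Ici_subset_orthant hVpos)) ?_ ?_
          · filter_upwards [ae_restrict_mem (MeasurableSet.pi countable_univ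
              fun _ _ => measurableSet_Ici)] with x hx
            exact hnn (fun j => (hVpos j).trans_le (hx j (mem_univ j)))
          · exact (show s m ≤ Set.pi univ (fun j => Ici (hV V j)) from
              fun x hx j hj => ((hVsmall j).le.trans (hx j hj) : hV V j ≤ x j)).eventuallyLE
      _ ≤ (∏ j, hV V j) * ∑' n : ι → ℕ+, g (latticePt (hV V) n) :=
          setIntegral_pi_Ici_le_mul_tsum hVpos hint hanti hnn
  · intro b hb
    filter_upwards [hpos] with V hVpos
    exact lt_of_le_of_lt (summable_latticePt_and_mul_tsum_le hVpos hint hanti hnn).2 hb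

end Antitone

/-! ### The Casimir lattice: levels as values of `e(k) = (π²/2)|k|²` at lattice points -/

/-- The free dispersion `e(k) = (π²/2) ∑_j k_j²` (so that `ε_{n,V} = e((n_j V^{-α_j})_j)`).
[cite: PuleZagrebnov2004, §1] -/
def energy (k : Fin 3 → ℝ) : ℝ := Real.pi ^ 2 / 2 * ∑ j, k j ^ 2

/-- The mesh `h_{V,j} = V^{-α_j}` of the Casimir lattice. [cite: PuleZagrebnov2004, §1] -/
def scale (α : Fin 3 → ℝ) (V : ℝ) : Fin 3 → ℝ := fun j => V ^ (-α j)

/-- `e(k) > 0` on the open orthant. [folklore] -/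
theorem energy_pos {k : Fin 3 → ℝ} (hk : ∀ j, 0 < k j) : 0 < energy k := by
  unfold energy
  have : 0 < ∑ j, k j ^ 2 := Finset.sum_pos (fun j _ => pow_pos (hk j) 2) Finset.univ_nonempty
  positivity

/-- `e(k) > 0` on the open orthant (set form). [folklore] -/
theorem energy_pos_of_mem_orthant {k : Fin 3 → ℝ} (hk : k ∈ orthant (Fin 3)) : 0 < energy k :=
  energy_pos fun j => hk j (mem_univ j)

/-- `e` is monotone on the closed orthant. [folklore] -/
theorem energy_mono {x y : Fin 3 → ℝ} (hx : ∀ j, 0 ≤ x j) (hxy : ∀ j, x j ≤ y j) :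
    energy x ≤ energy y := by
  unfold energy
  refine mul_le_mul_of_nonneg_left (Finset.sum_le_sum fun j _ => ?_) (by positivity)
  exact pow_le_pow_left₀ (hx j) (hxy j) 2

/-- `e` is continuous. [folklore] -/
theorem continuous_energy : Continuous energy := by
  unfold energy
  fun_prop

/-- `e` is measurable. [folklore] -/
theorem measurable_energy : Measurable energy := continuous_energy.measurable

/-- The meshes are positive. [folklore] -/
theorem scale_pos (α : Fin 3 → ℝ) {V : ℝ} (hV : 0 < V) (j : Fin 3) : 0 < scale α V j :=
  Real.rpow_pos_of_pos hV _

/-- The meshes tend to zero (`α_j > 0`). [folklore] -/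
theorem tendsto_scale (α : Fin 3 → ℝ) {j : Fin 3} (hα : 0 < α j) :
    Tendsto (fun V => scale α V j) atTop (𝓝 0) :=
  tendsto_rpow_neg_atTop hα

/-- The cell volume of the Casimir lattice is `∏_j V^{-α_j} = V⁻¹` (`∑ α_j = 1`).
[cite: PuleZagrebnov2004, §1] -/
theorem prod_scale (α : Fin 3 → ℝ) (hα : α 0 + α 1 + α 2 = 1) {V : ℝ} (hV : 0 < V) :
    ∏ j, scale α V j = V⁻¹ := by
  simp only [scale, Fin.prod_univ_three]
  rw [← Real.rpow_add hV, ← Real.rpow_add hV, ← Real.rpow_neg_one]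
  congr 1
  linarith

/-- `ε_{n,V} = e(h_V · n)`: the Dirichlet levels are the dispersion at the lattice points.
[cite: PuleZagrebnov2004, §1] -/
theorem level_eq_energy_latticePt (α : Fin 3 → ℝ) {V : ℝ} (hV : 0 < V) (n : Mode) :
    level α V n = energy (latticePt (scale α V) n) := by
  simp only [level, energy, latticePt, scale]
  congr 1
  refine Finset.sum_congr rfl fun j _ => ?_
  have h2 : (V ^ (-α j)) ^ 2 = (V ^ (2 * α j))⁻¹ := by
    rw [← Real.rpow_natCast, ← Real.rpow_mul hV.le, ← Real.rpow_neg hV.le]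
    congr 1
    push_cast
    ring
  rw [mul_pow, h2, div_eq_mul_inv, mul_comm]

/-- **Riemann sums over the Dirichlet levels.** For `φ ≥ 0` antitone on `(0,∞)` with
`φ ∘ e` integrable on the octant, and Casimir exponents `α_j > 0`, `∑ α_j = 1`:
`V⁻¹ ∑_n φ(ε_{n,V}) → ∫_{(0,∞)³} φ(e(k)) dk` as `V → ∞` (the Weyl-law limit `F_V → F` of
Pulé–Zagrebnov §1, in Riemann-sum form). [cite: PuleZagrebnov2004, §1 (lim-IDS), Lemma 3.1] -/
theorem tendsto_inv_mul_tsum_comp_level (α : Fin 3 → ℝ) (hαpos : ∀ j, 0 < α j)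
    (hαsum : α 0 + α 1 + α 2 = 1) {φ : ℝ → ℝ} (hφanti : AntitoneOn φ (Ioi 0))
    (hφnn : ∀ η, 0 < η → 0 ≤ φ η)
    (hφint : IntegrableOn (fun k => φ (energy k)) (orthant (Fin 3))) :
    Tendsto (fun V : ℝ => V⁻¹ * ∑' n : Mode, φ (level α V n)) atTop
      (𝓝 (∫ k in orthant (Fin 3), φ (energy k))) := by
  have hanti : ∀ ⦃x y : Fin 3 → ℝ⦄, (∀ j, 0 < x j) → (∀ j, x j ≤ y j) →
      φ (energy y) ≤ φ (energy x) := fun x y hx hxy =>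
    hφanti (energy_pos hx) (energy_pos fun j => (hx j).trans_le (hxy j))
      (energy_mono (fun j => (hx j).le) hxy)
  have hnn : ∀ ⦃x : Fin 3 → ℝ⦄, (∀ j, 0 < x j) → 0 ≤ φ (energy x) := fun x hx =>
    hφnn _ (energy_pos hx)
  have h := tendsto_mul_tsum_latticePt (g := fun k => φ (energy k)) (hV := scale α) hφint hanti
    hnn ((eventually_gt_atTop 0).mono fun V hV j => scale_pos α hV j)
    (fun j => tendsto_scale α (hαpos j))
  refine h.congr' ?_
  filter_upwards [eventually_gt_atTop 0] with V hV
  rw [prod_scale α hαsum hV]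
  congr 1
  exact tsum_congr fun n => by rw [level_eq_energy_latticePt α hV n]

/-- Summability of `n ↦ φ(ε_{n,V})` under the same hypotheses. [folklore] -/
theorem summable_comp_level (α : Fin 3 → ℝ) {V : ℝ} (hV : 0 < V) {φ : ℝ → ℝ}
    (hφanti : AntitoneOn φ (Ioi 0)) (hφnn : ∀ η, 0 < η → 0 ≤ φ η)
    (hφint : IntegrableOn (fun k => φ (energy k)) (orthant (Fin 3))) :
    Summable fun n : Mode => φ (level α V n) := by
  have hanti : ∀ ⦃x y : Fin 3 → ℝ⦄, (∀ j, 0 < x j) → (∀ j, x j ≤ y j) →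
      φ (energy y) ≤ φ (energy x) := fun x y hx hxy =>
    hφanti (energy_pos hx) (energy_pos fun j => (hx j).trans_le (hxy j))
      (energy_mono (fun j => (hx j).le) hxy)
  have hnn : ∀ ⦃x : Fin 3 → ℝ⦄, (∀ j, 0 < x j) → 0 ≤ φ (energy x) := fun x hx =>
    hφnn _ (energy_pos hx)
  have := (summable_latticePt_and_mul_tsum_le (g := fun k => φ (energy k))
    (scale_pos α hV) hφint hanti hnn).1
  simpa only [level_eq_energy_latticePt α hV] using this

/-- Integrability transfer: if `|ψ(e(k))| ≤ φ(e(k))` on the octant with `ψ ∘ e` measurable and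
`φ ∘ e` integrable, then `ψ ∘ e` is integrable on the octant. [folklore] -/
theorem integrableOn_comp_energy_of_le {φ ψ : ℝ → ℝ} (hψ : Measurable ψ)
    (hφint : IntegrableOn (fun k => φ (energy k)) (orthant (Fin 3)))
    (hle : ∀ η, 0 < η → |ψ η| ≤ φ η) :
    IntegrableOn (fun k => ψ (energy k)) (orthant (Fin 3)) := by
  refine Integrable.mono' hφint (hψ.comp measurable_energy).aestronglyMeasurable ?_
  filter_upwards [ae_restrict_mem measurableSet_orthant] with k hk
  rw [Real.norm_eq_abs]
  exact hle _ (energy_pos_of_mem_orthant hk)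

/-! ### The critical density as an octant integral of the Bose function -/

section CriticalDensity

variable {β : ℝ}

/-- Geometric expansion of the Bose function: `(e^{βη} - 1)⁻¹ = ∑_{ℓ ≥ 0} e^{-(ℓ+1)βη}` for
`β, η > 0`. [folklore] -/
theorem hasSum_exp_neg_gcOccupation (hβ : 0 < β) {η : ℝ} (hη : 0 < η) :
    HasSum (fun ℓ : ℕ => Real.exp (-((((ℓ : ℝ) + 1) * β) * η))) (gcOccupation β η 0) := by
  set r := Real.exp (-(β * η)) with hr
  have hr0 : 0 < r := Real.exp_pos _
  have hr1 : r < 1 := Real.exp_lt_one_iff.2 (neg_lt_zero.2 (mul_pos hβ hη))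
  have h := (hasSum_geometric_of_lt_one hr0.le hr1).mul_left r
  have hf : (fun ℓ : ℕ => Real.exp (-((((ℓ : ℝ) + 1) * β) * η))) = fun ℓ => r * r ^ ℓ := by
    funext ℓ
    rw [← pow_succ', hr, ← Real.exp_nat_mul]
    congr 1
    push_cast
    ring
  have hv : gcOccupation β η 0 = r * (1 - r)⁻¹ := by
    unfold gcOccupation
    have hexp : Real.exp (β * (η - 0)) = r⁻¹ := by rw [sub_zero, hr, Real.exp_neg, inv_inv]
    have h1r : (1 - r) ≠ 0 := (sub_pos.2 hr1).ne'
    rw [hexp, show r⁻¹ - 1 = (1 - r) / r by field_simp, inv_div, div_eq_mul_inv]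
  rw [hf, hv]
  exact h

/-- The Boltzmann factor of the free dispersion factorises over the coordinates. [folklore] -/
theorem exp_neg_mul_energy_eq_prod (c : ℝ) (k : Fin 3 → ℝ) :
    Real.exp (-(c * energy k)) = ∏ j, Real.exp (-(c * (Real.pi ^ 2 / 2)) * k j ^ 2) := by
  rw [← Real.exp_sum]
  congr 1
  simp only [energy, Finset.mul_sum, ← Finset.sum_neg_distrib]
  exact Finset.sum_congr rfl fun j _ => by ring

/-- **Octant Gaussian integral**: `∫_{(0,∞)³} e^{-c e(k)} dk = (½√(π/(cπ²/2)))³` for `c > 0`.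
[folklore] -/
theorem integral_orthant_exp_neg_mul_energy (c : ℝ) :
    ∫ k in orthant (Fin 3), Real.exp (-(c * energy k)) =
      (Real.sqrt (Real.pi / (c * (Real.pi ^ 2 / 2))) / 2) ^ 3 := by
  simp_rw [exp_neg_mul_energy_eq_prod]
  unfold orthant
  rw [volume_pi, Measure.restrict_pi_pi,
    integral_fintype_prod_eq_pow (fun x : ℝ => Real.exp (-(c * (Real.pi ^ 2 / 2)) * x ^ 2)),
    integral_gaussian_Ioi, Fintype.card_fin]

/-- The octant Gaussian is integrable. [folklore] -/
theorem integrableOn_exp_neg_mul_energy {c : ℝ} (hc : 0 < c) :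
    IntegrableOn (fun k => Real.exp (-(c * energy k))) (orthant (Fin 3)) := by
  simp_rw [exp_neg_mul_energy_eq_prod]
  unfold orthant IntegrableOn
  rw [volume_pi, Measure.restrict_pi_pi]
  exact Integrable.fintype_prod (f := fun _ x => Real.exp (-(c * (Real.pi ^ 2 / 2)) * x ^ 2))
    fun _ => (integrable_exp_neg_mul_sq (by positivity)).integrableOn

/-- `Γ(3/2) = √π/2`. [folklore] -/
theorem Gamma_three_halves : Real.Gamma (3 / 2) = Real.sqrt Real.pi / 2 := by
  rw [show (3 / 2 : ℝ) = 1 / 2 + 1 by norm_num, Real.Gamma_add_one (by norm_num),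
    Real.Gamma_one_half_eq]
  ring

/-- The numerical identity `(½√(π/(rπ²/2)))³ = (√2/2π²) · r^{-3/2} · (√π/2)` matching the octant
Gaussian with the `η^{1/2}`-moment of `e^{-rη}`. [folklore] -/
theorem octant_const_eq {r : ℝ} (hr : 0 < r) :
    (Real.sqrt (Real.pi / (r * (Real.pi ^ 2 / 2))) / 2) ^ 3 =
      Real.sqrt 2 / (2 * Real.pi ^ 2) * ((1 / r) ^ (3 / 2 : ℝ) * (Real.sqrt Real.pi / 2)) := by
  have hπ := Real.pi_pos
  have hx : 0 ≤ Real.pi / (r * (Real.pi ^ 2 / 2)) := by positivity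
  have hL : 0 ≤ (Real.sqrt (Real.pi / (r * (Real.pi ^ 2 / 2))) / 2) ^ 3 := by positivity
  have hR : 0 ≤ Real.sqrt 2 / (2 * Real.pi ^ 2) *
      ((1 / r) ^ (3 / 2 : ℝ) * (Real.sqrt Real.pi / 2)) := by positivity
  rw [← Real.sqrt_sq hL, ← Real.sqrt_sq hR]
  congr 1
  have h1 : ((1 / r) ^ (3 / 2 : ℝ)) ^ 2 = (1 / r) ^ 3 := by
    rw [← Real.rpow_natCast, ← Real.rpow_mul (by positivity)]
    norm_num
  have h2 : (Real.sqrt (Real.pi / (r * (Real.pi ^ 2 / 2)))) ^ 2 = Real.pi / (r * (Real.pi ^ 2 / 2)) :=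
    Real.sq_sqrt hx
  have h3 : Real.sqrt 2 ^ 2 = 2 := Real.sq_sqrt (by norm_num)
  have h4 : Real.sqrt Real.pi ^ 2 = Real.pi := Real.sq_sqrt hπ.le
  calc ((Real.sqrt (Real.pi / (r * (Real.pi ^ 2 / 2))) / 2) ^ 3) ^ 2
      = ((Real.sqrt (Real.pi / (r * (Real.pi ^ 2 / 2)))) ^ 2) ^ 3 / 64 := by ring
    _ = (Real.pi / (r * (Real.pi ^ 2 / 2))) ^ 3 / 64 := by rw [h2]
    _ = (Real.sqrt 2 ^ 2) / (2 * Real.pi ^ 2) ^ 2 * ((1 / r) ^ 3 * (Real.sqrt Real.pi ^ 2 / 4)) := by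
        rw [h3, h4]
        field_simp
        ring
    _ = _ := by rw [← h1]; ring

/-- The `ℓ`-th term on the line: `∫₀^∞ (√2/2π²) √t e^{-(ℓ+1)βt} dt = (√2/2π²)((ℓ+1)β)^{-3/2} √π/2`.
[folklore] -/
theorem integral_Ioi_sqrt_mul_exp_neg (hβ : 0 < β) (ℓ : ℕ) :
    ∫ t in Ioi (0 : ℝ), Real.sqrt 2 / (2 * Real.pi ^ 2) * Real.sqrt t *
        Real.exp (-((((ℓ : ℝ) + 1) * β) * t)) =
      Real.sqrt 2 / (2 * Real.pi ^ 2) *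
        ((1 / (((ℓ : ℝ) + 1) * β)) ^ (3 / 2 : ℝ) * (Real.sqrt Real.pi / 2)) := by
  have hr : 0 < ((ℓ : ℝ) + 1) * β := by positivity
  have key := Real.integral_rpow_mul_exp_neg_mul_Ioi (a := 3 / 2) (r := ((ℓ : ℝ) + 1) * β)
    (by norm_num) hr
  rw [← Gamma_three_halves, ← key, ← integral_const_mul]
  refine setIntegral_congr_fun measurableSet_Ioi fun t _ => ?_
  rw [Real.sqrt_eq_rpow t, show (3 / 2 : ℝ) - 1 = 1 / 2 by norm_num]
  ring

/-- Integrability of the `ℓ`-th term on the line. [folklore] -/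
theorem integrableOn_sqrt_mul_exp_neg (hβ : 0 < β) (ℓ : ℕ) :
    IntegrableOn (fun t : ℝ => Real.sqrt 2 / (2 * Real.pi ^ 2) * Real.sqrt t *
      Real.exp (-((((ℓ : ℝ) + 1) * β) * t))) (Ioi 0) := by
  have hr : 0 < ((ℓ : ℝ) + 1) * β := by positivity
  have h := integrableOn_rpow_mul_exp_neg_mul_rpow (s := 1 / 2) (p := 1) (b := ((ℓ : ℝ) + 1) * β)
    (by norm_num) le_rfl hr
  have h' := Integrable.const_mul h (Real.sqrt 2 / (2 * Real.pi ^ 2))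
  refine IntegrableOn.congr_fun h' (fun t _ => ?_) measurableSet_Ioi
  simp only [Real.rpow_one, Real.sqrt_eq_rpow, neg_mul]
  ring

/-- Summability of the terms `(√2/2π²)((ℓ+1)β)^{-3/2}(√π/2)` (a `p`-series with `p = 3/2`).
[folklore] -/
theorem summable_lineTerm (hβ : 0 < β) :
    Summable fun ℓ : ℕ => Real.sqrt 2 / (2 * Real.pi ^ 2) *
      ((1 / (((ℓ : ℝ) + 1) * β)) ^ (3 / 2 : ℝ) * (Real.sqrt Real.pi / 2)) := by
  have h1 : Summable fun ℓ : ℕ => (((ℓ : ℝ) + 1) ^ (3 / 2 : ℝ))⁻¹ := by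
    have := (summable_nat_add_iff 1).2
      (Real.summable_nat_rpow_inv.2 (by norm_num : (1 : ℝ) < 3 / 2))
    simpa only [Nat.cast_add, Nat.cast_one] using this
  have h2 := h1.mul_left
    (Real.sqrt 2 / (2 * Real.pi ^ 2) * (β ^ (3 / 2 : ℝ))⁻¹ * (Real.sqrt Real.pi / 2))
  refine h2.congr fun ℓ => ?_
  have hl : 0 ≤ (ℓ : ℝ) + 1 := by positivity
  rw [one_div, Real.inv_rpow (by positivity), Real.mul_rpow hl hβ.le]
  ring

/-- The terms are nonnegative. [folklore] -/
theorem lineTerm_nonneg (hβ : 0 < β) (ℓ : ℕ) :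
    0 ≤ Real.sqrt 2 / (2 * Real.pi ^ 2) *
      ((1 / (((ℓ : ℝ) + 1) * β)) ^ (3 / 2 : ℝ) * (Real.sqrt Real.pi / 2)) := by
  have : 0 < ((ℓ : ℝ) + 1) * β := by positivity
  positivity

/-- The `ℓ`-th term on the octant equals the `ℓ`-th term on the line. [folklore] -/
theorem integral_orthant_term (hβ : 0 < β) (ℓ : ℕ) :
    ∫ k in orthant (Fin 3), Real.exp (-((((ℓ : ℝ) + 1) * β) * energy k)) =
      Real.sqrt 2 / (2 * Real.pi ^ 2) *
        ((1 / (((ℓ : ℝ) + 1) * β)) ^ (3 / 2 : ℝ) * (Real.sqrt Real.pi / 2)) := by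
  have hr : 0 < ((ℓ : ℝ) + 1) * β := by positivity
  rw [integral_orthant_exp_neg_mul_energy, octant_const_eq hr]

/-- `φ₀ ∘ e` is measurable. [folklore] -/
theorem measurable_gcOccupation_energy (β μ : ℝ) :
    Measurable fun k : Fin 3 → ℝ => gcOccupation β (energy k) μ := by
  unfold gcOccupation
  exact ((Real.measurable_exp.comp ((measurable_energy.sub_const μ).const_mul β)).sub_const 1).inv

/-- **The Bose function of the free dispersion is integrable on the octant** (`β > 0`), i.e.
`ρ_c(β) < ∞`. [cite: PuleZagrebnov2004, §1 (cr-dens)] -/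
theorem integrableOn_gcOccupation_energy (hβ : 0 < β) :
    IntegrableOn (fun k => gcOccupation β (energy k) 0) (orthant (Fin 3)) := by
  refine ⟨(measurable_gcOccupation_energy β 0).aestronglyMeasurable, ?_⟩
  have hnn : 0 ≤ᵐ[volume.restrict (orthant (Fin 3))] fun k => gcOccupation β (energy k) 0 := by
    filter_upwards [ae_restrict_mem measurableSet_orthant] with k hk
    exact (gcOccupation_pos hβ (by simpa using energy_pos_of_mem_orthant hk)).le
  rw [hasFiniteIntegral_iff_ofReal hnn]
  have hF : ∀ ℓ : ℕ, 0 < ((ℓ : ℝ) + 1) * β := fun ℓ => by positivity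
  have hmeasF : ∀ ℓ : ℕ, Measurable fun k : Fin 3 → ℝ =>
      ENNReal.ofReal (Real.exp (-((((ℓ : ℝ) + 1) * β) * energy k))) := fun ℓ =>
    (Real.measurable_exp.comp (measurable_energy.const_mul _).neg).ennreal_ofReal
  calc ∫⁻ k in orthant (Fin 3), ENNReal.ofReal (gcOccupation β (energy k) 0)
      = ∫⁻ k in orthant (Fin 3), ∑' ℓ : ℕ,
          ENNReal.ofReal (Real.exp (-((((ℓ : ℝ) + 1) * β) * energy k))) := by
        refine setLIntegral_congr_fun measurableSet_orthant fun k hk => ?_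
        have hs := hasSum_exp_neg_gcOccupation hβ (energy_pos_of_mem_orthant hk)
        rw [← hs.tsum_eq, ENNReal.ofReal_tsum_of_nonneg (fun ℓ => (Real.exp_pos _).le) hs.summable]
    _ = ∑' ℓ : ℕ, ∫⁻ k in orthant (Fin 3),
          ENNReal.ofReal (Real.exp (-((((ℓ : ℝ) + 1) * β) * energy k))) :=
        lintegral_tsum fun ℓ => (hmeasF ℓ).aemeasurable
    _ = ∑' ℓ : ℕ, ENNReal.ofReal
          (∫ k in orthant (Fin 3), Real.exp (-((((ℓ : ℝ) + 1) * β) * energy k))) :=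
        tsum_congr fun ℓ => (ofReal_integral_eq_lintegral_ofReal
          (integrableOn_exp_neg_mul_energy (hF ℓ))
          (Eventually.of_forall fun k => (Real.exp_pos _).le)).symm
    _ = ∑' ℓ : ℕ, ENNReal.ofReal (Real.sqrt 2 / (2 * Real.pi ^ 2) *
          ((1 / (((ℓ : ℝ) + 1) * β)) ^ (3 / 2 : ℝ) * (Real.sqrt Real.pi / 2))) :=
        tsum_congr fun ℓ => by rw [integral_orthant_term hβ ℓ]
    _ = ENNReal.ofReal (∑' ℓ : ℕ, Real.sqrt 2 / (2 * Real.pi ^ 2) *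
          ((1 / (((ℓ : ℝ) + 1) * β)) ^ (3 / 2 : ℝ) * (Real.sqrt Real.pi / 2))) :=
        (ENNReal.ofReal_tsum_of_nonneg (lineTerm_nonneg hβ) (summable_lineTerm hβ)).symm
    _ < ⊤ := ENNReal.ofReal_lt_top

/-- **The critical density is the octant integral of the Bose function of the free
dispersion**: `∫_{(0,∞)³} (e^{βe(k)} - 1)⁻¹ dk = ∫₀^∞ (e^{βη} - 1)⁻¹ F(dη) = ρ_c(β)` with
`F(dη) = (√2/2π²) η^{1/2} dη` (both sides equal `∑_{ℓ≥1} (2πℓβ)^{-3/2} = ζ(3/2)/λ_β³`).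
[cite: PuleZagrebnov2004, §1 (cr-dens)] -/
theorem integral_orthant_gcOccupation_energy (hβ : 0 < β) :
    ∫ k in orthant (Fin 3), gcOccupation β (energy k) 0 = criticalDensity β := by
  have hF : ∀ ℓ : ℕ, 0 < ((ℓ : ℝ) + 1) * β := fun ℓ => by positivity
  -- octant side
  have h3 : ∫ k in orthant (Fin 3), gcOccupation β (energy k) 0 =
      ∑' ℓ : ℕ, Real.sqrt 2 / (2 * Real.pi ^ 2) *
        ((1 / (((ℓ : ℝ) + 1) * β)) ^ (3 / 2 : ℝ) * (Real.sqrt Real.pi / 2)) := by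
    rw [setIntegral_congr_fun measurableSet_orthant
      (g := fun k => ∑' ℓ : ℕ, Real.exp (-((((ℓ : ℝ) + 1) * β) * energy k)))
      (fun k hk => (hasSum_exp_neg_gcOccupation hβ (energy_pos_of_mem_orthant hk)).tsum_eq.symm)]
    rw [← integral_tsum_of_summable_integral_norm]
    · exact tsum_congr fun ℓ => integral_orthant_term hβ ℓ
    · exact fun ℓ => integrableOn_exp_neg_mul_energy (hF ℓ)
    · refine (summable_lineTerm hβ).congr fun ℓ => ?_
      rw [← integral_orthant_term hβ ℓ]
      exact integral_congr_ae (Eventually.of_forall fun k =>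
        (Real.norm_of_nonneg (Real.exp_pos _).le).symm)
  -- line side
  have h1 : criticalDensity β =
      ∑' ℓ : ℕ, Real.sqrt 2 / (2 * Real.pi ^ 2) *
        ((1 / (((ℓ : ℝ) + 1) * β)) ^ (3 / 2 : ℝ) * (Real.sqrt Real.pi / 2)) := by
    unfold criticalDensity
    rw [setIntegral_congr_fun measurableSet_Ioi
      (g := fun t => ∑' ℓ : ℕ, Real.sqrt 2 / (2 * Real.pi ^ 2) * Real.sqrt t *
        Real.exp (-((((ℓ : ℝ) + 1) * β) * t))) (fun t ht => ?_)]
    · rw [← integral_tsum_of_summable_integral_norm]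
      · exact tsum_congr fun ℓ => integral_Ioi_sqrt_mul_exp_neg hβ ℓ
      · exact fun ℓ => integrableOn_sqrt_mul_exp_neg hβ ℓ
      · refine (summable_lineTerm hβ).congr fun ℓ => ?_
        rw [← integral_Ioi_sqrt_mul_exp_neg hβ ℓ]
        exact integral_congr_ae (Eventually.of_forall fun t =>
          (Real.norm_of_nonneg (by positivity)).symm)
    · have hs := (hasSum_exp_neg_gcOccupation hβ (show (0 : ℝ) < t from ht)).mul_left
        (Real.sqrt 2 / (2 * Real.pi ^ 2) * Real.sqrt t)
      simp only [gcOccupation, sub_zero] at hs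
      exact hs.tsum_eq.symm
  rw [h3, h1]

end CriticalDensity

/-! ### The chemical potentials `μ_V(ρ)` tend to zero above the critical density -/

section ChemicalPotential

/-- `η ↦ ⟨N⟩(η, μ)` is measurable. [folklore] -/
theorem measurable_gcOccupation (β μ : ℝ) : Measurable fun η : ℝ => gcOccupation β η μ := by
  unfold gcOccupation
  exact ((Real.measurable_exp.comp ((measurable_id.sub_const μ).const_mul β)).sub_const 1).inv

/-- The levels are positive (`V > 0`). [cite: PuleZagrebnov2004, §1] -/
theorem level_pos (α : Fin 3 → ℝ) {V : ℝ} (hV : 0 < V) (n : Mode) : 0 < level α V n := by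
  rw [level_eq_energy_latticePt α hV]
  exact energy_pos (latticePt_pos (scale_pos α hV) n)

/-- The ground level tends to zero: `E₁(V) = (π²/2) ∑_j V^{-2α_j} → 0` (`α_j > 0`).
[cite: PuleZagrebnov2004, §1] -/
theorem tendsto_level_groundMode (α : Fin 3 → ℝ) (hα : ∀ j, 0 < α j) :
    Tendsto (fun V => level α V groundMode) atTop (𝓝 0) := by
  have h : ∀ j, Tendsto (fun V : ℝ => (1 : ℝ) / V ^ (2 * α j)) atTop (𝓝 0) := fun j => by
    refine (tendsto_rpow_neg_atTop (y := 2 * α j) (by linarith [hα j])).congr' ?_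
    filter_upwards [eventually_gt_atTop 0] with V hV
    rw [Real.rpow_neg hV.le, one_div]
  have hsum : Tendsto (fun V : ℝ => ∑ j, (1 : ℝ) / V ^ (2 * α j)) atTop (𝓝 0) := by
    simpa using tendsto_finsetSum Finset.univ fun j _ => h j
  have hlev : ∀ V : ℝ, level α V groundMode = Real.pi ^ 2 / 2 * ∑ j, (1 : ℝ) / V ^ (2 * α j) :=
    fun V => by simp [level]
  simp_rw [hlev]
  simpa using hsum.const_mul (Real.pi ^ 2 / 2)

/-- For `μ₀ ≤ 0`, `η ↦ ⟨N⟩(η, μ₀)` is antitone and nonnegative on `(0,∞)` and dominated by the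
Bose function `⟨N⟩(η, 0)`, hence `⟨N⟩(e(k), μ₀)` is integrable on the octant. [folklore] -/
theorem integrableOn_gcOccupation_energy_of_nonpos {β μ₀ : ℝ} (hβ : 0 < β) (hμ₀ : μ₀ ≤ 0) :
    IntegrableOn (fun k => gcOccupation β (energy k) μ₀) (orthant (Fin 3)) :=
  integrableOn_comp_energy_of_le (φ := fun η => gcOccupation β η 0) (measurable_gcOccupation β μ₀)
    (integrableOn_gcOccupation_energy hβ) fun η hη => by
      rw [abs_of_nonneg (gcOccupation_pos hβ (hμ₀.trans_lt hη)).le]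
      exact gcOccupation_mono_mu hβ hμ₀ hη

/-- **`μ_V(ρ) → 0` for `ρ > ρ_c`** ([BergLew-82, Thm. 1], Pulé–Zagrebnov Prop. 2.1, the
qualitative part): for Casimir exponents, `β > 0`, `ρ > ρ_c(β)` and any eventual family of
roots `μ_V` of the density equation, `μ_V → 0`. Upper bound: `μ_V < E₁(V) → 0`; lower bound:
if `μ_V ≤ a < 0` then `ρ = V⁻¹∑_n ⟨N_n⟩(μ_V) ≤ V⁻¹∑_n ⟨N_n⟩(a) → ∫_{(0,∞)³}⟨N⟩(e(k),a) dk
≤ ρ_c < ρ`. [cite: PuleZagrebnov2004, Prop. 2.1] -/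
theorem tendsto_chemicalPotential_zero {α : Fin 3 → ℝ} (hα : IsCasimirExponent α) {β : ℝ}
    (hβ : 0 < β) {ρ : ℝ} (hρ : criticalDensity β < ρ) (μ : ℝ → ℝ)
    (hroot : ∀ᶠ V : ℝ in atTop, IsDensityRoot α β ρ V (μ V)) :
    Tendsto μ atTop (𝓝 0) := by
  have hαpos := hα.pos
  rw [tendsto_order]
  constructor
  · intro a ha
    have hanti : AntitoneOn (fun η => gcOccupation β η a) (Ioi 0) :=
      fun x hx y _ hxy => gcOccupation_anti hβ (ha.trans hx) hxy
    have hnn : ∀ η, 0 < η → 0 ≤ gcOccupation β η a := fun η hη =>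
      (gcOccupation_pos hβ (ha.trans hη)).le
    have hint := integrableOn_gcOccupation_energy_of_nonpos hβ ha.le
    have hlim := tendsto_inv_mul_tsum_comp_level α hαpos hα.sum_eq_one hanti hnn hint
    have hI : ∫ k in orthant (Fin 3), gcOccupation β (energy k) a < ρ := by
      calc ∫ k in orthant (Fin 3), gcOccupation β (energy k) a
          ≤ ∫ k in orthant (Fin 3), gcOccupation β (energy k) 0 :=
            setIntegral_mono_on hint (integrableOn_gcOccupation_energy hβ) measurableSet_orthant
              fun k hk => gcOccupation_mono_mu hβ ha.le (energy_pos_of_mem_orthant hk)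
        _ = criticalDensity β := integral_orthant_gcOccupation_energy hβ
        _ < ρ := hρ
    filter_upwards [hlim.eventually (gt_mem_nhds hI), hroot, eventually_gt_atTop 0] with V hV hR hV0
    by_contra hcon
    push Not at hcon
    obtain ⟨_, hhas⟩ := hR
    have hle : ∀ n : Mode, gcOccupation β (level α V n) (μ V) ≤ gcOccupation β (level α V n) a :=
      fun n => gcOccupation_mono_mu hβ hcon (ha.trans (level_pos α hV0 n))
    have h1 : ρ * V ≤ ∑' n : Mode, gcOccupation β (level α V n) a := by
      rw [← hhas.tsum_eq]
      exact hhas.summable.tsum_le_tsum hle (summable_comp_level α hV0 hanti hnn hint)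
    have h2 : ∑' n : Mode, gcOccupation β (level α V n) a < V * ρ := (inv_mul_lt_iff₀ hV0).1 hV
    linarith
  · intro b hb
    filter_upwards [(tendsto_level_groundMode α hαpos).eventually (gt_mem_nhds hb), hroot]
      with V hV hR
    exact hR.1.trans hV

end ChemicalPotential

/-! ### Occupation above a fixed energy: Weyl limit and the ratio squeeze -/

section Tails

variable {β : ℝ}

/-- **Weyl limit of the truncated Bose sums.** For Casimir exponents, `β > 0` and `ε > 0`:
`V⁻¹ ∑_{n : ε_{n,V} ≥ ε} (e^{βε_{n,V}} - 1)⁻¹ → ∫_{(0,∞)³ ∩ {e ≥ ε}} (e^{βe(k)} - 1)⁻¹ dk`, and the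
truncated family is summable for every `V > 0` (write the truncation as the difference of the
two antitone functions `φ₀(max(η,ε))` and `φ₀(ε)𝟙_{η<ε}`).
[cite: PuleZagrebnov2004, §1 (lim-IDS), (cr-dens)] -/
theorem tendsto_inv_mul_tsum_truncated (α : Fin 3 → ℝ) (hα : IsCasimirExponent α) (hβ : 0 < β)
    {ε : ℝ} (hε : 0 < ε) :
    Tendsto (fun V : ℝ => V⁻¹ * ∑' n : Mode,
        (if ε ≤ level α V n then gcOccupation β (level α V n) 0 else 0)) atTop
      (𝓝 (∫ k in orthant (Fin 3),
        (if ε ≤ energy k then gcOccupation β (energy k) 0 else 0))) ∧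
    ∀ V : ℝ, 0 < V → Summable fun n : Mode =>
        (if ε ≤ level α V n then gcOccupation β (level α V n) 0 else 0) := by
  set u₁ : ℝ → ℝ := fun η => gcOccupation β (max η ε) 0 with hu₁
  set u₂ : ℝ → ℝ := fun η => if η < ε then gcOccupation β ε 0 else 0 with hu₂
  have hψ : ∀ η : ℝ, (if ε ≤ η then gcOccupation β η 0 else 0) = u₁ η - u₂ η := by
    intro η
    simp only [hu₁, hu₂]
    by_cases h : ε ≤ η
    · rw [if_pos h, max_eq_left h, if_neg (not_lt.2 h), sub_zero]
    · push Not at h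
      rw [if_neg (not_le.2 h), max_eq_right h.le, if_pos h, sub_self]
  -- hypotheses of the Riemann lemma for `u₁`
  have h1anti : AntitoneOn u₁ (Ioi 0) := fun x _ y _ hxy =>
    gcOccupation_anti hβ (lt_max_of_lt_right hε) (max_le_max_right ε hxy)
  have h1nn : ∀ η, 0 < η → 0 ≤ u₁ η := fun η _ =>
    (gcOccupation_pos hβ (lt_max_of_lt_right hε)).le
  have h1int : IntegrableOn (fun k => u₁ (energy k)) (orthant (Fin 3)) :=
    integrableOn_comp_energy_of_le (φ := fun η => gcOccupation β η 0)
      ((measurable_gcOccupation β 0).comp (measurable_id.max measurable_const))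
      (integrableOn_gcOccupation_energy hβ) fun η hη => by
        rw [abs_of_nonneg (h1nn η hη)]
        exact gcOccupation_anti hβ hη (le_max_left η ε)
  -- hypotheses of the Riemann lemma for `u₂`
  have h2nn : ∀ η, 0 < η → 0 ≤ u₂ η := fun η _ => by
    simp only [hu₂]
    split_ifs
    exacts [(gcOccupation_pos hβ hε).le, le_rfl]
  have h2anti : AntitoneOn u₂ (Ioi 0) := fun x hx y _ hxy => by
    by_cases hy' : y < ε
    · simp only [hu₂, if_pos hy', if_pos (lt_of_le_of_lt hxy hy'), le_rfl]
    · simp only [hu₂, if_neg hy']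
      exact h2nn x hx
  have h2int : IntegrableOn (fun k => u₂ (energy k)) (orthant (Fin 3)) :=
    integrableOn_comp_energy_of_le (φ := fun η => gcOccupation β η 0)
      (Measurable.ite measurableSet_Iio measurable_const measurable_const)
      (integrableOn_gcOccupation_energy hβ) fun η hη => by
        rw [abs_of_nonneg (h2nn η hη)]
        simp only [hu₂]
        split_ifs with h
        · exact gcOccupation_anti hβ hη h.le
        · exact (gcOccupation_pos hβ hη).le
  have hl1 := tendsto_inv_mul_tsum_comp_level α hα.pos hα.sum_eq_one h1anti h1nn h1int
  have hl2 := tendsto_inv_mul_tsum_comp_level α hα.pos hα.sum_eq_one h2anti h2nn h2int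
  have hs1 : ∀ V : ℝ, 0 < V → Summable fun n : Mode => u₁ (level α V n) := fun V hV =>
    summable_comp_level α hV h1anti h1nn h1int
  have hs2 : ∀ V : ℝ, 0 < V → Summable fun n : Mode => u₂ (level α V n) := fun V hV =>
    summable_comp_level α hV h2anti h2nn h2int
  refine ⟨?_, fun V hV => ((hs1 V hV).sub (hs2 V hV)).congr fun n => (hψ _).symm⟩
  have hlim := hl1.sub hl2
  rw [← integral_sub h1int h2int] at hlim
  have heq : (fun k : Fin 3 → ℝ => u₁ (energy k) - u₂ (energy k)) =
      fun k => if ε ≤ energy k then gcOccupation β (energy k) 0 else 0 :=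
    funext fun k => (hψ _).symm
  rw [heq] at hlim
  refine hlim.congr' ?_
  filter_upwards [eventually_gt_atTop 0] with V hV
  rw [← mul_sub, ← (hs1 V hV).tsum_sub (hs2 V hV)]
  congr 1
  exact tsum_congr fun n => (hψ _).symm

/-- **Ratio bound, upper**: for `0 ≤ δ < ε ≤ η` and `m ≤ δ`,
`⟨N⟩(η, m) ≤ [(e^{βε}-1)/(e^{β(ε-δ)}-1)] · ⟨N⟩(η, 0)` (the ratio `(u-1)/(au-1)`, `a = e^{-βδ}`,
decreases in `u = e^{βη}`). [folklore] -/
theorem gcOccupation_le_ratio_mul (hβ : 0 < β) {ε δ η m : ℝ} (hδ0 : 0 ≤ δ) (hδε : δ < ε)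
    (hη : ε ≤ η) (hm : m ≤ δ) :
    gcOccupation β η m ≤
      (Real.exp (β * ε) - 1) / (Real.exp (β * (ε - δ)) - 1) * gcOccupation β η 0 := by
  refine (gcOccupation_mono_mu hβ hm (hδε.trans_le hη)).trans ?_
  unfold gcOccupation
  rw [sub_zero]
  set a := Real.exp (-(β * δ)) with ha
  set U := Real.exp (β * η) with hU
  set U₀ := Real.exp (β * ε) with hU₀
  have hA : Real.exp (β * (η - δ)) = a * U := by
    rw [ha, hU, ← Real.exp_add]; congr 1; ring
  have hB : Real.exp (β * (ε - δ)) = a * U₀ := by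
    rw [ha, hU₀, ← Real.exp_add]; congr 1; ring
  have ha1 : a ≤ 1 := Real.exp_le_one_iff.2 (by nlinarith)
  have ha0 : 0 < a := Real.exp_pos _
  have hB1 : 1 < a * U₀ := by
    rw [← hB]; exact Real.one_lt_exp_iff.2 (mul_pos hβ (by linarith))
  have hU1 : 1 < U₀ := Real.one_lt_exp_iff.2 (mul_pos hβ (hδ0.trans_lt hδε))
  have hUU : U₀ ≤ U := Real.exp_le_exp.2 (by nlinarith)
  have hAU1 : 1 < a * U := lt_of_lt_of_le hB1 (mul_le_mul_of_nonneg_left hUU ha0.le)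
  rw [hA, hB, ← div_eq_mul_inv, div_div, inv_eq_one_div,
    div_le_div_iff₀ (by linarith) (mul_pos (by linarith) (by linarith))]
  nlinarith [mul_nonneg (sub_nonneg.2 ha1) (sub_nonneg.2 hUU)]

/-- **Ratio bound, lower**: for `0 ≤ δ`, `0 < ε ≤ η`, `-δ ≤ m < η`,
`[(e^{βε}-1)/(e^{β(ε+δ)}-1)] · ⟨N⟩(η, 0) ≤ ⟨N⟩(η, m)` (the ratio `(u-1)/(bu-1)`, `b = e^{βδ}`,
increases in `u = e^{βη}`). [folklore] -/
theorem ratio_mul_gcOccupation_le (hβ : 0 < β) {ε δ η m : ℝ} (hδ0 : 0 ≤ δ) (hε : 0 < ε)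
    (hη : ε ≤ η) (hm : -δ ≤ m) (hmη : m < η) :
    (Real.exp (β * ε) - 1) / (Real.exp (β * (ε + δ)) - 1) * gcOccupation β η 0 ≤
      gcOccupation β η m := by
  refine le_trans ?_ (gcOccupation_mono_mu hβ hm hmη)
  unfold gcOccupation
  rw [sub_zero, sub_neg_eq_add]
  set b := Real.exp (β * δ) with hb
  set U := Real.exp (β * η) with hU
  set U₀ := Real.exp (β * ε) with hU₀
  have hA : Real.exp (β * (η + δ)) = b * U := by
    rw [hb, hU, ← Real.exp_add]; congr 1; ring
  have hB : Real.exp (β * (ε + δ)) = b * U₀ := by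
    rw [hb, hU₀, ← Real.exp_add]; congr 1; ring
  have hb1 : 1 ≤ b := Real.one_le_exp_iff.2 (by nlinarith)
  have hU1 : 1 < U₀ := Real.one_lt_exp_iff.2 (mul_pos hβ hε)
  have hUU : U₀ ≤ U := Real.exp_le_exp.2 (by nlinarith)
  have hB1 : 1 < b * U₀ := by nlinarith
  have hA1 : 1 < b * U := by nlinarith
  rw [hA, hB, ← div_eq_mul_inv, div_div, inv_eq_one_div,
    div_le_div_iff₀ (mul_pos (by linarith) (by linarith)) (by linarith)]
  nlinarith [mul_nonneg (sub_nonneg.2 hb1) (sub_nonneg.2 hUU)]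

/-- The truncated occupation family at the root is summable and nonnegative. [folklore] -/
theorem summable_truncated_gcOccupation (α : Fin 3 → ℝ) (hβ : 0 < β) {ρ V m ε : ℝ} (hV : 0 < V)
    (hR : IsDensityRoot α β ρ V m) :
    Summable fun n : Mode =>
      (if ε ≤ level α V n then gcOccupation β (level α V n) m else 0) := by
  obtain ⟨hμE, hhas⟩ := hR
  have h0 : ∀ n : Mode, 0 ≤ gcOccupation β (level α V n) m := fun n =>
    (gcOccupation_pos hβ (hμE.trans_le (level_groundMode_le α hV n))).le
  refine Summable.of_nonneg_of_le (fun n => ?_) (fun n => ?_) hhas.summable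
  · split_ifs
    exacts [h0 n, le_rfl]
  · split_ifs
    exacts [le_rfl, h0 n]

/-- **Tails of the occupation at the root.** For Casimir exponents, `β > 0`, `ρ > ρ_c`, an
eventual family of roots `μ_V` and `ε > 0`:
`V⁻¹ ∑_{n : ε_{n,V} ≥ ε} ⟨N_n⟩(μ_V) → ∫_{(0,∞)³ ∩ {e ≥ ε}} (e^{βe(k)} - 1)⁻¹ dk`
(squeeze between the ratio bounds at `δ = |μ_V| → 0`).
[cite: PuleZagrebnov2004, §1 (cr-dens), Prop. 2.1] -/
theorem tendsto_inv_mul_tsum_tail {α : Fin 3 → ℝ} (hα : IsCasimirExponent α) (hβ : 0 < β)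
    {ρ : ℝ} (hρ : criticalDensity β < ρ) (μ : ℝ → ℝ)
    (hroot : ∀ᶠ V : ℝ in atTop, IsDensityRoot α β ρ V (μ V)) {ε : ℝ} (hε : 0 < ε) :
    Tendsto (fun V : ℝ => V⁻¹ * ∑' n : Mode,
        (if ε ≤ level α V n then gcOccupation β (level α V n) (μ V) else 0)) atTop
      (𝓝 (∫ k in orthant (Fin 3),
        (if ε ≤ energy k then gcOccupation β (energy k) 0 else 0))) := by
  obtain ⟨hS, hSsum⟩ := tendsto_inv_mul_tsum_truncated α hα hβ hε
  have hμ0 := tendsto_chemicalPotential_zero hα hβ hρ μ hroot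
  have hδ : Tendsto (fun V => |μ V|) atTop (𝓝 0) := by simpa using hμ0.abs
  have hU₀1 : 1 < Real.exp (β * ε) := Real.one_lt_exp_iff.2 (mul_pos hβ hε)
  have hne : Real.exp (β * ε) - 1 ≠ 0 := (sub_pos.2 hU₀1).ne'
  -- the two ratios tend to `1`
  have hCup : Tendsto (fun V => (Real.exp (β * ε) - 1) / (Real.exp (β * (ε - |μ V|)) - 1))
      atTop (𝓝 1) := by
    have h1 : Tendsto (fun V => Real.exp (β * (ε - |μ V|)) - 1) atTop
        (𝓝 (Real.exp (β * ε) - 1)) := by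
      have h2 : Tendsto (fun V => β * (ε - |μ V|)) atTop (𝓝 (β * (ε - 0))) :=
        (tendsto_const_nhds.sub hδ).const_mul β
      have := ((Real.continuous_exp.tendsto _).comp h2).sub_const 1
      simpa using this
    have := (tendsto_const_nhds (x := Real.exp (β * ε) - 1)).div h1 hne
    rwa [div_self hne] at this
  have hClo : Tendsto (fun V => (Real.exp (β * ε) - 1) / (Real.exp (β * (ε + |μ V|)) - 1))
      atTop (𝓝 1) := by
    have h1 : Tendsto (fun V => Real.exp (β * (ε + |μ V|)) - 1) atTop
        (𝓝 (Real.exp (β * ε) - 1)) := by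
      have h2 : Tendsto (fun V => β * (ε + |μ V|)) atTop (𝓝 (β * (ε + 0))) :=
        (tendsto_const_nhds.add hδ).const_mul β
      have := ((Real.continuous_exp.tendsto _).comp h2).sub_const 1
      simpa using this
    have := (tendsto_const_nhds (x := Real.exp (β * ε) - 1)).div h1 hne
    rwa [div_self hne] at this
  have hlo := hClo.mul hS
  have hup := hCup.mul hS
  rw [one_mul] at hlo hup
  refine tendsto_of_tendsto_of_tendsto_of_le_of_le' hlo hup ?_ ?_
  · filter_upwards [hδ.eventually (gt_mem_nhds hε), hroot, eventually_gt_atTop 0]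
      with V hδV hR hV0
    rw [mul_left_comm]
    refine mul_le_mul_of_nonneg_left ?_ (inv_nonneg.2 hV0.le)
    rw [← tsum_mul_left]
    refine Summable.tsum_le_tsum (fun n => ?_) ((hSsum V hV0).mul_left _)
      (summable_truncated_gcOccupation α hβ hV0 hR)
    split_ifs with h
    · exact ratio_mul_gcOccupation_le hβ (abs_nonneg _) hε h (neg_abs_le _)
        ((le_abs_self _).trans_lt (hδV.trans_le h))
    · simp
  · filter_upwards [hδ.eventually (gt_mem_nhds hε), hroot, eventually_gt_atTop 0]
      with V hδV hR hV0
    rw [mul_left_comm]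
    refine mul_le_mul_of_nonneg_left ?_ (inv_nonneg.2 hV0.le)
    rw [← tsum_mul_left]
    refine Summable.tsum_le_tsum (fun n => ?_) (summable_truncated_gcOccupation α hβ hV0 hR)
      ((hSsum V hV0).mul_left _)
    split_ifs with h
    · exact gcOccupation_le_ratio_mul hβ (abs_nonneg _) hδV h (le_abs_self _)
    · simp

/-- **The band occupation converges.** With `g(ε) := ρ - ∫_{(0,∞)³ ∩ {e ≥ ε}} (e^{βe(k)}-1)⁻¹dk`:
`V⁻¹ ∑_{n : ε_{n,V} < ε} ⟨N_n⟩(μ_V) → g(ε)` (the density equation gives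
`V⁻¹∑_{ε_n < ε} = ρ - V⁻¹∑_{ε_n ≥ ε}`). [cite: PuleZagrebnov2004, §1 (ρ₀ display)] -/
theorem tendsto_bandOccupation {α : Fin 3 → ℝ} (hα : IsCasimirExponent α) (hβ : 0 < β)
    {ρ : ℝ} (hρ : criticalDensity β < ρ) (μ : ℝ → ℝ)
    (hroot : ∀ᶠ V : ℝ in atTop, IsDensityRoot α β ρ V (μ V)) {ε : ℝ} (hε : 0 < ε) :
    Tendsto (fun V : ℝ => V⁻¹ * ∑' n : {n : Mode // level α V n < ε},
        gcOccupation β (level α V n.1) (μ V)) atTop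
      (𝓝 (ρ - ∫ k in orthant (Fin 3),
        (if ε ≤ energy k then gcOccupation β (energy k) 0 else 0))) := by
  refine (tendsto_const_nhds.sub (tendsto_inv_mul_tsum_tail hα hβ hρ μ hroot hε)).congr' ?_
  filter_upwards [hroot, eventually_gt_atTop 0] with V hR hV0
  have hsite := summable_truncated_gcOccupation α hβ (ε := ε) hV0 hR
  obtain ⟨_, hhas⟩ := hR
  have hsub : ∑' n : {n : Mode // level α V n < ε}, gcOccupation β (level α V n.1) (μ V) =
      ∑' n : Mode, {n : Mode | level α V n < ε}.indicator
        (fun n => gcOccupation β (level α V n) (μ V)) n :=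
    tsum_subtype {n : Mode | level α V n < ε} (fun n => gcOccupation β (level α V n) (μ V))
  have hind : ∀ n : Mode, {n : Mode | level α V n < ε}.indicator
      (fun n => gcOccupation β (level α V n) (μ V)) n =
      gcOccupation β (level α V n) (μ V) -
        (if ε ≤ level α V n then gcOccupation β (level α V n) (μ V) else 0) := by
    intro n
    by_cases h : level α V n < ε
    · rw [Set.indicator_of_mem (show n ∈ {n : Mode | level α V n < ε} from h),
        if_neg (not_le.2 h), sub_zero]
    · rw [Set.indicator_of_notMem (show n ∉ {n : Mode | level α V n < ε} from h),
        if_pos (not_lt.1 h), sub_self]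
  rw [hsub, tsum_congr hind, hhas.summable.tsum_sub hsite, hhas.tsum_eq, mul_sub,
    show V⁻¹ * (ρ * V) = ρ by field_simp]

/-- **The truncated Bose integral tends to the critical density**:
`∫_{(0,∞)³ ∩ {e ≥ ε}} (e^{βe(k)} - 1)⁻¹ dk → ρ_c(β)` as `ε ↓ 0` (dominated convergence).
[cite: PuleZagrebnov2004, §1 (cr-dens)] -/
theorem tendsto_truncatedIntegral (hβ : 0 < β) :
    Tendsto (fun ε : ℝ => ∫ k in orthant (Fin 3),
        (if ε ≤ energy k then gcOccupation β (energy k) 0 else 0))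
      (𝓝[>] 0) (𝓝 (criticalDensity β)) := by
  rw [← integral_orthant_gcOccupation_energy hβ]
  refine tendsto_integral_filter_of_dominated_convergence (fun k => gcOccupation β (energy k) 0)
    ?_ ?_ (integrableOn_gcOccupation_energy hβ) ?_
  · exact Eventually.of_forall fun ε =>
      (Measurable.ite (measurableSet_le measurable_const measurable_energy)
        (measurable_gcOccupation_energy β 0) measurable_const).aestronglyMeasurable
  · refine Eventually.of_forall fun ε => ?_
    filter_upwards [ae_restrict_mem measurableSet_orthant] with k hk
    have h0 := (gcOccupation_pos hβ (energy_pos_of_mem_orthant hk) (μ := 0)).le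
    rw [Real.norm_eq_abs]
    split_ifs
    · exact (abs_of_nonneg h0).le
    · rw [abs_zero]; exact h0
  · filter_upwards [ae_restrict_mem measurableSet_orthant] with k hk
    have hk0 := energy_pos_of_mem_orthant hk
    refine (tendsto_const_nhds (x := gcOccupation β (energy k) 0)).congr' ?_
    have : ∀ᶠ ε in 𝓝[>] (0 : ℝ), ε < energy k := mem_nhdsWithin_of_mem_nhds (gt_mem_nhds hk0)
    filter_upwards [this] with ε hεk
    rw [if_pos hεk.le]

end Tails

/-- **The van den Berg–Lewis–Pulé generalized condensate, proved**: for every Casimir box,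
`β > 0`, `ρ > ρ_c(β)` and every eventual family of roots `μ_V(ρ)` of the density equation,
the band occupations `V⁻¹ ∑_{n : ε_{n,V} < ε} ⟨N_n⟩(μ_V(ρ))` converge for every `ε > 0`, to
`g(ε) = ρ - ∫_{(0,∞)³ ∩ {e ≥ ε}} (e^{βe(k)} - 1)⁻¹ dk`, and `g(ε) → ρ - ρ_c` as `ε ↓ 0`:
"`ρ₀ := lim_{ε↓0} lim_{V→∞} V⁻¹ ∑_{k : E_k(V) < ε} ⟨N_k⟩_V^{gcan}(μ_V(ρ)) = ρ - ρ_c`, for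
`ρ > ρ_c`". Architecture: Weyl-law limit of antitone lattice sums (`tendsto_mul_tsum_latticePt`,
`tendsto_inv_mul_tsum_comp_level`), `ρ_c = ∫_{(0,∞)³}(e^{βe(k)}-1)⁻¹dk`
(`integral_orthant_gcOccupation_energy`), `μ_V → 0` (`tendsto_chemicalPotential_zero`), ratio
squeeze of the tails (`tendsto_inv_mul_tsum_tail`), the density equation
(`tendsto_bandOccupation`) and dominated convergence (`tendsto_truncatedIntegral`).
[cite: PuleZagrebnov2004, §1 (display defining ρ₀)]
[cite: VandenbergLewisPule1986, via PuleZagrebnov2004 §1] -/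
theorem VandenBergLewisPule1986_generalizedCondensate_holds :
    VandenBergLewisPule1986_generalizedCondensate := by
  intro α hα β hβ ρ hρ μ hroot
  exact ⟨fun ε => ρ - ∫ k in orthant (Fin 3),
      (if ε ≤ energy k then gcOccupation β (energy k) 0 else 0),
    fun ε hε => tendsto_bandOccupation hα hβ hρ μ hroot hε,
    tendsto_const_nhds.sub (tendsto_truncatedIntegral hβ)⟩

end Literature.Barriers.AtomisticToContinuum.BoseGas.Casimir

/-! ### The barrier witness assembled (audit 2026-08-15)

With the generalized-condensate fact proved above, "condensation without a macroscopically
occupied level" (van den Berg–Lewis–Pulé type III) holds unconditionally in Lean for every Casimir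
box with `α₁ > 1/2`: the two theorems below discharge the hypothesis of
`Literature.Barriers.AtomisticToContinuum.CasimirBoxGeneralizedCondensation.typeIII` and record the
existence form (non-vacuity: exponents `(3/5, 1/5, 1/5)`, roots of the density equation exist). -/

namespace Literature.Barriers.AtomisticToContinuum

open BoseGas.Casimir

/-- The critical density is nonnegative (its integrand `(√2/2π²)√η (e^{βη}-1)⁻¹` is `≥ 0` on
`(0,∞)` for `β > 0`). [cite: PuleZagrebnov2004, §1 (cr-dens)] -/
theorem BoseGas.Casimir.criticalDensity_nonneg {β : ℝ} (hβ : 0 < β) : 0 ≤ criticalDensity β := by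
  unfold criticalDensity
  refine setIntegral_nonneg measurableSet_Ioi fun η hη => ?_
  have hη : 0 < η := hη
  have h1 : 0 < Real.exp (β * η) - 1 := by
    have : 1 < Real.exp (β * η) := Real.one_lt_exp_iff.2 (mul_pos hβ hη)
    linarith
  have h2 : 0 < (Real.exp (β * η) - 1)⁻¹ := inv_pos.2 h1
  positivity

/-- **Type III in Casimir boxes, unconditionally: generalized condensation `ρ - ρ_c > 0` with no
macroscopically occupied level.** For every Casimir box with `α₁ > 1/2`, every `β > 0`, every
`ρ > ρ_c(β)` and every eventual family of roots `μ_V(ρ)` of the density equation, the band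
occupations `V⁻¹∑_{ε_{n,V} < ε}⟨N_n⟩(μ_V)` converge for every `ε > 0` to some `g(ε)` with
`g(ε) → ρ - ρ_c > 0` as `ε ↓ 0` ("there is generalized BEC"), while `V⁻¹⟨N_n⟩(μ_V) → 0` for EVERY
level `n` ("no single-particle state is macroscopically occupied (BEC of type III)"). This is
`CasimirBoxGeneralizedCondensation.typeIII` with its hypothesis discharged by
`VandenBergLewisPule1986_generalizedCondensate_holds`.
[cite: PuleZagrebnov2004, §1 (display defining ρ₀) and Prop. 2.2 (iii)] -/
theorem casimirBox_typeIII {α : Fin 3 → ℝ} (hα : IsCasimirExponent α) (h12 : 1 / 2 < α 0)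
    {β : ℝ} (hβ : 0 < β) {ρ : ℝ} (hρ : criticalDensity β < ρ) (μ : ℝ → ℝ)
    (hroot : ∀ᶠ V : ℝ in atTop, IsDensityRoot α β ρ V (μ V)) :
    (∃ g : ℝ → ℝ,
        (∀ ε : ℝ, 0 < ε →
          Tendsto (fun V : ℝ => V⁻¹ * ∑' n : {n : Mode // level α V n < ε},
            gcOccupation β (level α V n.1) (μ V)) atTop (𝓝 (g ε))) ∧
        Tendsto g (𝓝[>] 0) (𝓝 (ρ - criticalDensity β)) ∧ 0 < ρ - criticalDensity β) ∧
      ∀ n : Mode,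
        Tendsto (fun V : ℝ => V⁻¹ * gcOccupation β (level α V n) (μ V)) atTop (𝓝 0) :=
  CasimirBoxGeneralizedCondensation.typeIII VandenBergLewisPule1986_generalizedCondensate_holds
    hα h12 hβ hρ μ hroot

/-- **Existence form of the barrier witness.** There are Casimir exponents with `α₁ > 1/2`
(e.g. `(3/5, 1/5, 1/5)`) such that for every `β > 0` and every `ρ > ρ_c(β)` there is a family of
roots `μ_V(ρ) < E₁(V)` of the density equation (for all large `V`) along which the perfect Bose
gas shows generalized condensation `ρ - ρ_c > 0` although every level is `o(V)` — type III, no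
hypothesis left open. [cite: PuleZagrebnov2004, Prop. 2.2 (iii)] -/
theorem exists_casimirBox_typeIII :
    ∃ α : Fin 3 → ℝ, IsCasimirExponent α ∧ 1 / 2 < α 0 ∧
      ∀ β : ℝ, 0 < β → ∀ ρ : ℝ, criticalDensity β < ρ →
        ∃ μ : ℝ → ℝ, (∀ᶠ V : ℝ in atTop, IsDensityRoot α β ρ V (μ V)) ∧
          (∃ g : ℝ → ℝ,
              (∀ ε : ℝ, 0 < ε →
                Tendsto (fun V : ℝ => V⁻¹ * ∑' n : {n : Mode // level α V n < ε},
                  gcOccupation β (level α V n.1) (μ V)) atTop (𝓝 (g ε))) ∧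
              Tendsto g (𝓝[>] 0) (𝓝 (ρ - criticalDensity β)) ∧ 0 < ρ - criticalDensity β) ∧
          ∀ n : Mode,
            Tendsto (fun V : ℝ => V⁻¹ * gcOccupation β (level α V n) (μ V)) atTop (𝓝 0) := by
  obtain ⟨α, hα, h12⟩ := exists_isCasimirExponent_half_lt
  refine ⟨α, hα, h12, fun β hβ ρ hρ => ?_⟩
  have hρ0 : 0 < ρ := (criticalDensity_nonneg hβ).trans_lt hρ
  obtain ⟨μ, hroot⟩ := exists_eventually_isDensityRoot α hβ hρ0
  exact ⟨μ, hroot, casimirBox_typeIII hα h12 hβ hρ μ hroot⟩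

end Literature.Barriers.AtomisticToContinuum
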